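import Summits.HodgeConjecture.HodgeConjecture.Theses.PadicSemiregularLift
import Summits.HodgeConjecture.HodgeConjecture.Theses.QbarEnvelope
import Summits.HodgeConjecture.HodgeConjecture.Theses.AdelicCoherence
import Summits.HodgeConjecture.HodgeConjecture.Theorems.PadicSemiregularLiftHodgeAbelianVarietiesStarSeedsEngine
import Literature.AlgebraicGeometry.Crystalline.PadicAnchorDefs

/-!
# Crux `HodgeBeyondAnchors` (stmt-HodgeConjecture-14054), line `IdeatorFiveSketch`
# (card `coherent-plane-object-engine`): the object engine with P1b TYPED, and the two funnels

Route `PadicSemiregularLift` of `HodgeConjecture`. Helper file (`--supports stmt-HodgeConjecture-14054`) for the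
lead's skeleton `Cruxes/HodgeBeyondAnchors/Lines/IdeatorFiveSketch.lean`; every statement is over the tree's
vocabulary, the route items being consumed BY NAME as hypotheses (so the lemmas are conditional on them, by design).

* `liftsTo_of_zeroOneSemiregular` — THE ENGINE ENTRY POINT now that P1b is typed: on a `W(k)`-model with the standing
  hypotheses of P1a (`PadicAnchor.ModelHypotheses`), a finite locally free `{0,1}`-semiregular `E` on the special fibre
  with the Bloch–Esnault–Kerz Hodge condition lifts to the model — P1b `PadicPridhamSemiregularity` gives (⋆),
  `BlochEsnaultKerzLifting C` + P1a `FormalLiftingFromClassLifting` give `LiftsFormally`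
  (`…StarSeedsEngine.liftsFormally_of_hodgeCondition_of_star`), P3a `FormalVectorBundlesAlgebraize` gives `LiftsTo`.
* `bo_chCris_mem_span_of_zeroOneSemiregular`, `mem_span_ratAlgebraicClasses_of_mem_span_seeds` — hence the
  Berthelot–Ogus image of `chᵣ^cris` of such a seed, and every `K`-combination of such images, is a `K`-combination of
  `ℚ`-algebraic de Rham classes of the generic fibre (the engine OUTPUT the card's stub `NumberFieldSeeds` feeds).
* `four_le_forces_cotangent_free` — the TYPED RANGE of the engine: P1a's clause `d ≤ 3 ∨ Ω¹_{𝒳/W} free` forces a free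
  cotangent sheaf on every model of relative dimension `≥ 4` to which the engine applies (so, in print, a
  parallelizable — i.e. abelian — generic fibre: Wang 1954 / Borel–Remmert 1962); recorded because the crux excludes
  exactly the abelian `X` and is known for `n ≤ 3` (`HodgeBeyondAnchors.of_dim_le_three`).
* `hodgeBeyondAnchors_of_funnel` — QbarEnvelope's typed items `Envelope ∧ PullbackAlgebraic ∧ HodgeModels ∧
  HCOverNumberFields` give the crux BY NAME (its deciding theorem restricted off the anchors);
  `hodgeBeyondAnchors_of_adelicCoherence` — so do AdelicCoherence's items (its deciding theorem, with
  `HodgeModelsExist` discharged by the PROVED `QbarEnvelope.HodgeModels_holds`).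

References: Bloch–Esnault–Kerz, Invent. Math. 195 (2014) Thm. 1.3 [BlochEsnaultKerz2014pAdic]; Berthelot–Ogus,
Invent. Math. 72 (1983) Rem. 3.7.1 [BerthelotOgus1983]; H.-C. Wang, *Complex parallisable manifolds*, Proc. AMS 5
(1954) 771–776; Voisin, *Hodge loci and absolute Hodge classes*, Compos. Math. 143 (2007) Prop. 1.7 [Voisin2007HodgeLoci].
-/

-- `Summit.HodgeConjecture.HodgeConjecture.…` repeats a component by design (single-problem summit, CONVENTIONS §1).
set_option linter.dupNamespace false

noncomputable section

open CategoryTheory AlgebraicGeometry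
open scoped Isocrystal
open Literature.AlgebraicGeometry Literature.AlgebraicGeometry.Motives
  Literature.AlgebraicGeometry.Motives.WittScheme Literature.AlgebraicGeometry.HodgeTheory
  Literature.AlgebraicGeometry.Crystalline Literature.AlgebraicGeometry.KTheory
open Summit.HodgeConjecture.HodgeConjecture.Theses
open Summit.HodgeConjecture.HodgeConjecture.Theses.PadicSemiregularLift

namespace Summit.HodgeConjecture.HodgeConjecture.Theorems.HodgeBeyondAnchors.ObjectEngine

section Engine

variable {p : ℕ} [Fact p.Prime] {k : Type} [Field k] [CharP k p] [PerfectRing k p]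

/-- **The object engine, entry point `{0,1}`-semiregularity** (P1b → BEK + P1a → P3a, all BY NAME): on a model with
P1a's standing hypotheses, a finite locally free `{0,1}`-semiregular module on the special fibre satisfying the
Bloch–Esnault–Kerz Hodge condition lifts to a vector bundle on the model. Conditional on the route items P1b
(stmt-13815), P1a (stmt-13825), P3a (stmt-14106) and the predicate `BlochEsnaultKerzLifting C` (BEK Thm 1.3).
[cite: BlochEsnaultKerz2014pAdic, Thm. 1.3] -/
theorem liftsTo_of_zeroOneSemiregular (h1b : PadicPridhamSemiregularity) (h1a : FormalLiftingFromClassLifting)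
    (h3a : FormalVectorBundlesAlgebraize) (C : CrystallineRealization p k) (hBEK : BlochEsnaultKerzLifting C)
    {d : ℕ} {𝒳 : SchemeOver (WittVector p k)} (hM : PadicAnchor.ModelHypotheses d 𝒳)
    (E : (specialFibre 𝒳).left.Modules) (hE : IsFiniteLocallyFree E) (hsr : IsZeroOneSemiregular hE)
    (hH : C.HodgeCondition 𝒳 E) : LiftsTo 𝒳 E :=
  h3a p k d 𝒳 hM.smoothProper E
    (Cruxes.HodgeAbelianVarieties.InnerFormInvariantSeeds.Engine.liftsFormally_of_hodgeCondition_of_star h1a C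
      hBEK hM.smoothProper hM.projective hM.large hM.torsionFree_structureSheaf hM.torsionFree_hodgeOne
      hM.cotangent_free E hE hH (h1b p k d 𝒳 hM.smoothProper E hE hsr))

/-- **Engine output for one seed**: under the same hypotheses, for every `r` the Berthelot–Ogus image of `chᵣ^cris(E)`
lies in the `K`-span of the `ℚ`-algebraic de Rham classes of the generic fibre (`bo_chCris` = Berthelot–Ogus Rem. 3.7.1
applied to the algebraic lift). [cite: BerthelotOgus1983, Rem. 3.7.1] -/
theorem bo_chCris_mem_span_of_zeroOneSemiregular (h1b : PadicPridhamSemiregularity)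
    (h1a : FormalLiftingFromClassLifting) (h3a : FormalVectorBundlesAlgebraize)
    (C : CrystallineRealization p k) (hBEK : BlochEsnaultKerzLifting C)
    {d : ℕ} {𝒳 : SchemeOver (WittVector p k)} (hM : PadicAnchor.ModelHypotheses d 𝒳)
    (E : (specialFibre 𝒳).left.Modules) (hE : IsFiniteLocallyFree E) (hsr : IsZeroOneSemiregular hE)
    (hH : C.HodgeCondition 𝒳 E) (r : ℕ) :
    C.bo 𝒳 (2 * r) (C.chCris (specialFibre 𝒳) E r) ∈ Submodule.span K(p, k)
      (C.dR.ratAlgebraicClasses (genericFibre 𝒳) r : Set (C.dR.obj (genericFibre 𝒳) (2 * r))) :=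
  Cruxes.HodgeAbelianVarieties.InnerFormInvariantSeeds.Engine.bo_chCris_mem_span_of_liftsTo C hM.smoothProper
    (liftsTo_of_zeroOneSemiregular h1b h1a h3a C hBEK hM E hE hsr hH) r

/-- **Engine output for a seed span**: a `K`-combination of Berthelot–Ogus images of `chᵣ^cris` of finite locally free,
`{0,1}`-semiregular modules with the Hodge condition is a `K`-combination of `ℚ`-algebraic de Rham classes of the
generic fibre (the conclusion the card's stub `NumberFieldSeeds` feeds into descent). [cite: BlochEsnaultKerz2014pAdic, Thm. 1.3] -/
theorem mem_span_ratAlgebraicClasses_of_mem_span_seeds (h1b : PadicPridhamSemiregularity)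
    (h1a : FormalLiftingFromClassLifting) (h3a : FormalVectorBundlesAlgebraize)
    (C : CrystallineRealization p k) (hBEK : BlochEsnaultKerzLifting C)
    {d : ℕ} {𝒳 : SchemeOver (WittVector p k)} (hM : PadicAnchor.ModelHypotheses d 𝒳) {r : ℕ}
    {S : Set (specialFibre 𝒳).left.Modules}
    (hS : ∀ E ∈ S, ∃ hE : IsFiniteLocallyFree E, IsZeroOneSemiregular hE ∧ C.HodgeCondition 𝒳 E)
    {α : C.dR.obj (genericFibre 𝒳) (2 * r)}
    (hα : α ∈ Submodule.span K(p, k) ((fun E => C.bo 𝒳 (2 * r) (C.chCris (specialFibre 𝒳) E r)) '' S)) :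
    α ∈ Submodule.span K(p, k)
      (C.dR.ratAlgebraicClasses (genericFibre 𝒳) r : Set (C.dR.obj (genericFibre 𝒳) (2 * r))) := by
  refine (Submodule.span_le.mpr ?_) hα
  rintro _ ⟨E, hES, rfl⟩
  obtain ⟨hE, hsr, hH⟩ := hS E hES
  exact bo_chCris_mem_span_of_zeroOneSemiregular h1b h1a h3a C hBEK hM E hE hsr hH r

omit [PerfectRing k p] in
/-- **The typed range of the engine.** P1a's standing hypotheses in relative dimension `d ≥ 4` force the cotangent
sheaf `Ω¹_{𝒳/W}` to be free of rank `d` (the clause `d ≤ 3 ∨ Ω¹ free`); in print the generic fibre is then a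
parallelizable smooth projective variety, i.e. an abelian variety (Wang 1954; Borel–Remmert 1962) — the class the crux
`HodgeBeyondAnchors` excludes. [cite: BlochEsnaultKerz2014pAdic, Rem. 35 (2) (arXiv version)] -/
theorem four_le_forces_cotangent_free {d : ℕ} {𝒳 : SchemeOver (WittVector p k)} (hd : 4 ≤ d)
    (hM : PadicAnchor.ModelHypotheses d 𝒳) :
    Nonempty (cotangentSheaf 𝒳 ≅ SheafOfModules.free (R := 𝒳.left.ringCatSheaf) (Fin d)) :=
  hM.cotangent_free.resolve_left (by omega)

end Engine

/-! ### The two funnels: the crux BY NAME from the typed items of QbarEnvelope / AdelicCoherence -/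

/-- **QbarEnvelope's items give the crux.** From `Envelope` (stmt-1069), `PullbackAlgebraic` (stmt-1071),
`HodgeModels` (stmt-1943, PROVED) and `HCOverNumberFields` (stmt-1070), the remainder crux follows (QbarEnvelope's
deciding theorem `closes`, restricted off the anchors). [cite: Voisin2007HodgeLoci, Prop. 1.7] -/
theorem hodgeBeyondAnchors_of_funnel (hE : QbarEnvelope.Envelope) (hP : QbarEnvelope.PullbackAlgebraic)
    (hM : QbarEnvelope.HodgeModels) (hC : QbarEnvelope.HCOverNumberFields) :
    HodgeBeyondAnchors :=
  fun _ _ hX _ _ => QbarEnvelope.closes hE hC hP hM hX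

/-- `QbarEnvelope.HodgeModels` (PROVED in the tree) is AdelicCoherence's `HodgeModelsExist` (stmt-2742): the latter
unfolds to `∀ n X, IsSmoothProjective n X → Nonempty (HodgeModel n X)`. [cite: Deligne2000, §1] -/
theorem hodgeModelsExist_holds : AdelicCoherence.HodgeModelsExist :=
  fun n X hX => QbarEnvelope.HodgeModels_holds n X hX

/-- **AdelicCoherence's items give the crux.** From `FrobeniusPlanes` (stmt-13695), `CoherentClassesAlgebraic`
(stmt-13696 — the item the card proposes to supply an object engine for), `DeRhamPlanes` (stmt-13697), `QbarDescent`
(stmt-1200), `NumberFieldReduction` (stmt-13520) and `ClassicalPeriodData` (stmt-13698), the remainder crux follows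
(AdelicCoherence's deciding theorem `closes`, its hypothesis `HodgeModelsExist` discharged by `hodgeModelsExist_holds`,
then restriction off the anchors). [cite: Ogus1982, §4 (4.11)] -/
theorem hodgeBeyondAnchors_of_adelicCoherence (hF : AdelicCoherence.FrobeniusPlanes)
    (hC : AdelicCoherence.CoherentClassesAlgebraic) (hD : AdelicCoherence.DeRhamPlanes)
    (hQ : AdelicCoherence.QbarDescent) (hR : AdelicCoherence.NumberFieldReduction)
    (hP : AdelicCoherence.ClassicalPeriodData) : HodgeBeyondAnchors :=
  fun _ _ hX _ _ => AdelicCoherence.closes hF hC hD hQ hR hP hodgeModelsExist_holds hX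

end Summit.HodgeConjecture.HodgeConjecture.Theorems.HodgeBeyondAnchors.ObjectEngine

end
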